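import Summits.RiemannHypothesis.RiemannHypothesis.Theorems.JensenPolynomialsSkewFarStein

/-!
# Route `JensenPolynomials`, FAR crux `XiCumulantSkew98Far` — part 2: the far mode `a_s ≥ 9.45` and the quadratic
Taylor model of `W_s′` about the mode (RH-FREE; cell rh-jensen, HUMAN RULING D-0040)

For `s ≥ 4·10¹⁸` let `a = a_s = xiMode s` (mode of `W_s = −s log u − log Φ`), `A := 4πe^{4a}`. From the saddle equation
`s = a·L(a)` (`L = −Φ′/Φ`) and the tree's envelopes `4πe^{4u} − 9.005 ≤ L(u) ≤ 4πe^{4u} − 9` (`u ≥ 3/2`,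
`DeBruijnPhiLogDerivEnvelope.lean`) we get `a ≥ 9.45` (`xiMode_ge`) and `s/a + 9 ≤ A ≤ s/a + 9.005` (`A_bounds`). With

  `R := 4A + s/a²`,  `c := 8A − s/a³`,  `C₃ := 15A + 2s/a⁴`

the score `W_s′(u) = L(u) − s/u` satisfies on the bulk `|u − a| ≤ 1/100` the QUADRATIC MODEL WITH CUBIC REMAINDER

  `|W_s′(u) − R(u−a) − c(u−a)²| ≤ 1/200 + C₃|u−a|³`   (`bulk_bound`)

(exact algebra `W′ − Rt − ct² = (L(u) − Ae^{4t}) + (A − s/a) + A(e^{4t} − 1 − 4t − 8t²) + st³/(a³u)`, the envelope at `u`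
and at `a`, `Real.exp_bound`), and for every `u > 0` the Markov-inflated global form (`global_bound`)

  `|W_s′(u) − R(u−a) − c(u−a)²| ≤ 1/200 + C₃|u−a|³ + 10⁸(u−a)⁴·(|W_s′(u)| + R|u−a| + c(u−a)²)`.

These feed the Stein system of part 3. WHAT THIS IS NOT: nothing here bears on the zeros of `ζ`. References: Coffey–Csordas
2013 Prop. 2.1/Thm 2.4 [CoffeyCsordas2013]; GORZ 2019 Thm 7 [GORZPNAS2019].
-/

noncomputable section
-- D-0017: `Summit.RiemannHypothesis.RiemannHypothesis.…` duplicates the namespace BY DESIGN (single-problem summit).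
set_option linter.dupNamespace false

namespace Summit.RiemannHypothesis.RiemannHypothesis.Theorems.JensenPolynomials.SkewFar

open Literature.NumberTheory.LFunctions Literature.Probability.Distributions MeasureTheory Set Filter Real
open scoped Topology Nat

/-! ## 1. Numerics: `e^{37.8}` and the far mode -/

/-- `1.1719·10¹⁶ ≤ e³⁷ ≤ 1.172·10¹⁶`. -/
theorem exp_37_bounds : (1.1719e16 : ℝ) ≤ exp 37 ∧ exp 37 ≤ 1.172e16 := by
  have e : exp 37 = exp 1 ^ 37 := by rw [← Real.exp_nat_mul]; norm_num
  rw [e]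
  constructor
  · calc (1.1719e16 : ℝ) ≤ 2.7182818283 ^ 37 := by norm_num
      _ ≤ exp 1 ^ 37 := pow_le_pow_left₀ (by norm_num) Real.exp_one_gt_d9.le 37
  · calc exp 1 ^ 37 ≤ 2.7182818286 ^ 37 := pow_le_pow_left₀ (exp_pos 1).le Real.exp_one_lt_d9.le 37
      _ ≤ 1.172e16 := by norm_num

/-- `2.2255 ≤ e^{4/5} ≤ 2.2256`. -/
theorem exp_four_fifths_bounds : (2.2255 : ℝ) ≤ exp (4 / 5) ∧ exp (4 / 5) ≤ 2.2256 := by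
  constructor
  · have h := Real.sum_le_exp_of_nonneg (x := (4 / 5 : ℝ)) (by norm_num) 8
    have e : ∑ i ∈ Finset.range 8, (4 / 5 : ℝ) ^ i / i ! = 6085451 / 2734375 := by
      simp only [Finset.sum_range_succ, Finset.sum_range_zero, Nat.factorial]
      norm_num
    rw [e] at h
    linarith
  · have h := Real.exp_bound' (x := (4 / 5 : ℝ)) (by norm_num) (by norm_num) (n := 8) (by norm_num)
    have e : (∑ m ∈ Finset.range 8, (4 / 5 : ℝ) ^ m / m.factorial) + (4 / 5 : ℝ) ^ 8 * (8 + 1) / (Nat.factorial 8 * 8)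
        ≤ 2.2256 := by
      simp only [Finset.sum_range_succ, Finset.sum_range_zero, Nat.factorial]
      norm_num
    exact h.trans e

/-- `2.6·10¹⁶ ≤ e^{37.8} ≤ 2.61·10¹⁶` (`37.8 = 4·9.45`). -/
theorem exp_378_bounds : (2.6e16 : ℝ) ≤ exp (4 * (189 / 20)) ∧ exp (4 * (189 / 20)) ≤ 2.61e16 := by
  have e : exp (4 * (189 / 20)) = exp 37 * exp (4 / 5) := by rw [← Real.exp_add]; norm_num
  rw [e]
  obtain ⟨h1, h2⟩ := exp_37_bounds
  obtain ⟨h3, h4⟩ := exp_four_fifths_bounds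
  constructor
  · calc (2.6e16 : ℝ) ≤ 1.1719e16 * 2.2255 := by norm_num
      _ ≤ exp 37 * exp (4 / 5) := mul_le_mul h1 h3 (by norm_num) (exp_pos _).le
  · calc exp 37 * exp (4 / 5) ≤ 1.172e16 * 2.2256 := mul_le_mul h2 h4 (exp_pos _).le (by norm_num)
      _ ≤ 2.61e16 := by norm_num

/-- **The far mode**: `a_s ≥ 9.45` for every `s ≥ 4·10¹⁸` (`9.45·(4πe^{37.8} − 9) ≤ 3.1·10¹⁸ ≤ s` and the certified
lower mode bracket `le_xiMode_of_mul_le`). -/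
theorem xiMode_ge (s : ℕ) (hs : 4 * 10 ^ 18 ≤ s) : (189 / 20 : ℝ) ≤ xiMode (s : ℝ) := by
  have hs' : (4 * 10 ^ 18 : ℝ) ≤ (s : ℝ) := by exact_mod_cast hs
  have hspos : (0 : ℝ) < s := by linarith
  refine le_xiMode_of_mul_le hspos (by norm_num) (le_trans ?_ hs')
  have h := exp_378_bounds.2
  have hπ := Real.pi_lt_d6
  nlinarith [Real.pi_pos, exp_pos (4 * (189 / 20 : ℝ))]

/-- Bundle of mode facts for `s ≥ 4·10¹⁸`: `a > 0`, `a ≥ 9.45`, `W′(a) = 0`, `a·L(a) = s`. -/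
theorem mode_facts (s : ℕ) (hs : 4 * 10 ^ 18 ≤ s) :
    0 < xiMode (s : ℝ) ∧ (189 / 20 : ℝ) ≤ xiMode (s : ℝ) ∧ xiPotentialDeriv s (xiMode (s : ℝ)) = 0 ∧
      xiMode (s : ℝ) * phiNegLogDeriv (xiMode (s : ℝ)) = s := by
  have hs' : (4 * 10 ^ 18 : ℝ) ≤ (s : ℝ) := by exact_mod_cast hs
  have hspos : (0 : ℝ) < s := by linarith
  exact ⟨xiMode_pos hspos, xiMode_ge s hs, xiPotentialDeriv_xiMode hspos, xiMode_mul_phiNegLogDeriv hspos⟩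

/-! ## 2. The constants `A`, `R`, `c` at the far mode -/

/-- **`A = 4πe^{4a}` against `s/a`**: `s/a + 9 ≤ A ≤ s/a + 9.005` (saddle equation + envelopes at `a ≥ 3/2`). -/
theorem A_bounds (s : ℕ) (hs : 4 * 10 ^ 18 ≤ s) :
    (s : ℝ) / xiMode (s : ℝ) + 9 ≤ 4 * π * exp (4 * xiMode (s : ℝ)) ∧
      4 * π * exp (4 * xiMode (s : ℝ)) ≤ (s : ℝ) / xiMode (s : ℝ) + 9.005 := by
  obtain ⟨ha0, ha, _, hmode⟩ := mode_facts s hs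
  set a := xiMode (s : ℝ) with ha_def
  have hL : (s : ℝ) / a = phiNegLogDeriv a := by
    rw [← hmode]; field_simp
  have h1 := neg_deBruijnPhiDeriv_div_le ha0.le
  have h2 := le_neg_deBruijnPhiDeriv_div (show (3 : ℝ) / 2 ≤ a by linarith)
  rw [show -deBruijnPhiDeriv a / deBruijnPhi a = phiNegLogDeriv a from rfl] at h1 h2
  constructor <;> linarith

/-- Elementary consequences: `0 < A`, `s/a ≤ A ≤ 1.0001·s/a`, `0 < R`, `0 < c ≤ 2R`, and the normalisation
`4a + 1 ≤ R·a²/s ≤ 4a + 1 + 37a²/s`. -/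
theorem consts_facts (s : ℕ) (hs : 4 * 10 ^ 18 ≤ s) {A R c : ℝ} (hA : A = 4 * π * exp (4 * xiMode (s : ℝ)))
    (hR : R = 4 * A + s / xiMode (s : ℝ) ^ 2) (hc : c = 8 * A - s / xiMode (s : ℝ) ^ 3) :
    0 < A ∧ (s : ℝ) / xiMode (s : ℝ) ≤ A ∧ A ≤ 1.0001 * ((s : ℝ) / xiMode (s : ℝ)) ∧ 0 < R ∧ 0 < c ∧ c ≤ 2 * R ∧
      4 * xiMode (s : ℝ) + 1 ≤ R * xiMode (s : ℝ) ^ 2 / s ∧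
      R * xiMode (s : ℝ) ^ 2 / s ≤ 4 * xiMode (s : ℝ) + 1 + 37 * (xiMode (s : ℝ) ^ 2 / s) := by
  obtain ⟨ha0, ha, _, _⟩ := mode_facts s hs
  obtain ⟨hA1, hA2⟩ := A_bounds s hs
  set a := xiMode (s : ℝ) with ha_def
  rw [← hA] at hA1 hA2
  have hs' : (4 * 10 ^ 18 : ℝ) ≤ (s : ℝ) := by exact_mod_cast hs
  have hspos : (0 : ℝ) < s := by linarith
  have hsa : 0 < (s : ℝ) / a := div_pos hspos ha0
  -- `s/a ≥ 4·10¹⁷` hence `9.005 ≤ 0.0001·(s/a)`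
  have hsa_big : (9.005 : ℝ) ≤ 0.0001 * ((s : ℝ) / a) := by
    -- `a ≤ s/(4·10¹⁷)` would do; we use `s/a = L(a)`-free bound: `s ≥ 4e18` and `a ≤ s·…`? Simpler: `A ≥ s/a + 9 > 0` and
    -- `s/a ≥ s/a`; we need an upper bound on `a`: from `A ≤ s/a + 9.005` and `A = 4πe^{4a} ≥ 4π·2.6e16`:
    have hE : exp (4 * (189 / 20 : ℝ)) ≤ exp (4 * a) := exp_le_exp.2 (by linarith)
    have h26 := exp_378_bounds.1
    have hApos : 4 * π * (2.6e16 : ℝ) ≤ A := by rw [hA]; nlinarith [Real.pi_pos, Real.pi_gt_three]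
    nlinarith [Real.pi_gt_three]
  have hApos : 0 < A := by linarith
  have hsa2 : (s : ℝ) / a ^ 2 = ((s : ℝ) / a) / a := by rw [pow_two, div_div]
  have hsa3 : (s : ℝ) / a ^ 3 = ((s : ℝ) / a) / a ^ 2 := by rw [pow_succ, pow_two, div_div]; ring_nf
  have ha1 : (1 : ℝ) ≤ a := by linarith
  have hR0 : 0 < R := by rw [hR]; positivity
  -- `s/a³ ≤ (s/a)/a² ≤ s/a ≤ A`
  have hsa3le : (s : ℝ) / a ^ 3 ≤ A := by
    rw [hsa3]
    calc ((s : ℝ) / a) / a ^ 2 ≤ ((s : ℝ) / a) / 1 := div_le_div_of_nonneg_left hsa.le one_pos (by nlinarith)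
      _ = (s : ℝ) / a := div_one _
      _ ≤ A := by linarith
  have hc0 : 0 < c := by rw [hc]; linarith
  have hc2 : c ≤ 2 * R := by
    rw [hc, hR]
    have : 0 ≤ (s : ℝ) / a ^ 2 := by positivity
    have : 0 ≤ (s : ℝ) / a ^ 3 := by positivity
    linarith
  refine ⟨hApos, by linarith, by linarith, hR0, hc0, hc2, ?_, ?_⟩
  · -- `R a²/s = 4A a²/s + 1 ≥ 4a + 1` since `A a/s ≥ 1`
    rw [hR]
    have e : (4 * A + (s : ℝ) / a ^ 2) * a ^ 2 / s = 4 * (A * a / s) * a + 1 := by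
      field_simp
    rw [e]
    have h1 : 1 ≤ A * a / s := by
      rw [le_div_iff₀ hspos]
      have := (div_le_iff₀ ha0).1 (show (s : ℝ) / a ≤ A by linarith)
      linarith
    nlinarith
  · rw [hR]
    have e : (4 * A + (s : ℝ) / a ^ 2) * a ^ 2 / s = 4 * (A * a / s) * a + 1 := by
      field_simp
    rw [e]
    have h2 : A * a / s ≤ 1 + 9.005 * (a / s) := by
      rw [div_le_iff₀ hspos]
      have := (le_div_iff₀ ha0).1 (show A - 9.005 ≤ (s : ℝ) / a by linarith)
      have e2 : (1 + 9.005 * (a / (s : ℝ))) * s = s + 9.005 * a := by field_simp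
      rw [e2]
      linarith
    have ha2 : a ^ 2 / (s : ℝ) = a * (a / s) := by rw [pow_two, mul_div_assoc]
    rw [ha2]
    have : 0 ≤ a / (s : ℝ) := by positivity
    nlinarith

/-! ## 3. The quadratic model of `W_s′` on the bulk and its global Markov form -/

/-- Exact algebra behind the Taylor model: for `u, a ≠ 0`,
`W′(u) − R(u−a) − c(u−a)² = (L(u) − A e^{4(u−a)}) + (A − s/a) + A(e^{4(u−a)} − 1 − 4(u−a) − 8(u−a)²) + s(u−a)³/(a³u)`
with `R = 4A + s/a²`, `c = 8A − s/a³`. -/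
theorem model_identity (s A E a u : ℝ) (ha : a ≠ 0) (hu : u ≠ 0) :
    (-(s / u) + phiNegLogDeriv u) - (4 * A + s / a ^ 2) * (u - a) - (8 * A - s / a ^ 3) * (u - a) ^ 2 =
      (phiNegLogDeriv u - A * E) + (A - s / a) + A * (E - 1 - 4 * (u - a) - 8 * (u - a) ^ 2) +
        s * (u - a) ^ 3 / (a ^ 3 * u) := by
  field_simp
  ring

/-- `|e^x − 1 − x − x²/2| ≤ (2/9)|x|³` for `|x| ≤ 1` (`Real.exp_bound`, `n = 3`). -/
theorem abs_exp_sub_quadratic_le {x : ℝ} (hx : |x| ≤ 1) : |exp x - 1 - x - x ^ 2 / 2| ≤ 2 / 9 * |x| ^ 3 := by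
  have h := Real.exp_bound hx (n := 3) (by norm_num)
  have e : ∑ m ∈ Finset.range 3, x ^ m / m.factorial = 1 + x + x ^ 2 / 2 := by
    simp only [Finset.sum_range_succ, Finset.sum_range_zero, Nat.factorial]
    norm_num
  rw [e] at h
  have e2 : exp x - 1 - x - x ^ 2 / 2 = exp x - (1 + x + x ^ 2 / 2) := by ring
  rw [e2]
  refine h.trans (le_of_eq ?_)
  simp only [Nat.factorial, Nat.succ_eq_add_one]
  norm_num
  ring

/-- **Bulk bound.** For `s ≥ 4·10¹⁸`, `a = a_s`, `A = 4πe^{4a}`, `R = 4A + s/a²`, `c = 8A − s/a³` and `|u − a| ≤ 1/100`: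
`|W_s′(u) − R(u−a) − c(u−a)²| ≤ 1/200 + (15A + 2s/a⁴)|u − a|³`. -/
theorem bulk_bound (s : ℕ) (hs : 4 * 10 ^ 18 ≤ s) {A R c : ℝ} (hA : A = 4 * π * exp (4 * xiMode (s : ℝ)))
    (hR : R = 4 * A + s / xiMode (s : ℝ) ^ 2) (hc : c = 8 * A - s / xiMode (s : ℝ) ^ 3) {u : ℝ}
    (hu : |u - xiMode (s : ℝ)| ≤ 1 / 100) :
    |xiPotentialDeriv s u - R * (u - xiMode (s : ℝ)) - c * (u - xiMode (s : ℝ)) ^ 2| ≤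
      1 / 200 + (15 * A + 2 * s / xiMode (s : ℝ) ^ 4) * |u - xiMode (s : ℝ)| ^ 3 := by
  obtain ⟨ha0, ha, _, _⟩ := mode_facts s hs
  obtain ⟨hA1, hA2⟩ := A_bounds s hs
  obtain ⟨hApos, _⟩ := consts_facts s hs hA hR hc
  set a := xiMode (s : ℝ) with ha_def
  rw [← hA] at hA1 hA2
  set t := u - a with ht
  have htb := abs_le.1 hu
  have hu32 : (3 : ℝ) / 2 ≤ u := by linarith [htb.1]
  have hu0 : 0 < u := by linarith
  have hs' : (4 * 10 ^ 18 : ℝ) ≤ (s : ℝ) := by exact_mod_cast hs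
  have hspos : (0 : ℝ) < s := by linarith
  -- envelope at `u`, with `4πe^{4u} = A·e^{4t}`
  have hL1 := neg_deBruijnPhiDeriv_div_le hu0.le
  have hL2 := le_neg_deBruijnPhiDeriv_div hu32
  rw [show -deBruijnPhiDeriv u / deBruijnPhi u = phiNegLogDeriv u from rfl] at hL1 hL2
  have hexp : 4 * π * exp (4 * u) = A * exp (4 * t) := by
    rw [hA, ht, show 4 * u = 4 * a + 4 * (u - a) by ring, Real.exp_add]; ring
  rw [hexp] at hL1 hL2
  -- the identity
  have key := model_identity (s : ℝ) A (exp (4 * t)) a u ha0.ne' hu0.ne'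
  rw [show -((s : ℝ) / u) + phiNegLogDeriv u = xiPotentialDeriv s u from rfl, ← hR, ← hc, ← ht] at key
  rw [key]
  -- the four pieces
  have p12 : |phiNegLogDeriv u - A * exp (4 * t) + (A - (s : ℝ) / a)| ≤ 1 / 200 := by
    rw [abs_le]; constructor <;> linarith
  have p3 : |A * (exp (4 * t) - 1 - 4 * t - 8 * t ^ 2)| ≤ 15 * A * |t| ^ 3 := by
    have h4t : |4 * t| ≤ 1 := by rw [abs_mul, abs_of_pos (by norm_num : (0 : ℝ) < 4)]; linarith [abs_le.2 htb]
    have h := abs_exp_sub_quadratic_le h4t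
    have e1 : exp (4 * t) - 1 - 4 * t - (4 * t) ^ 2 / 2 = exp (4 * t) - 1 - 4 * t - 8 * t ^ 2 := by ring
    rw [e1] at h
    rw [abs_mul, abs_of_pos hApos]
    have e2 : |4 * t| ^ 3 = 64 * |t| ^ 3 := by rw [abs_mul, abs_of_pos (by norm_num : (0 : ℝ) < 4)]; ring
    rw [e2] at h
    have h2 := mul_le_mul_of_nonneg_left h hApos.le
    have h3 : 0 ≤ A * |t| ^ 3 := by positivity
    linarith
  have p4 : |(s : ℝ) * t ^ 3 / (a ^ 3 * u)| ≤ 2 * s / a ^ 4 * |t| ^ 3 := by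
    rw [abs_div, abs_mul, abs_of_pos hspos, abs_of_pos (by positivity : (0 : ℝ) < a ^ 3 * u), abs_pow,
      div_le_iff₀ (by positivity : (0 : ℝ) < a ^ 3 * u)]
    -- `a³u ≥ a⁴/2`
    have hu2 : a / 2 ≤ u := by linarith [htb.1]
    have h0 : 0 ≤ (s : ℝ) * |t| ^ 3 := by positivity
    have e : 2 * (s : ℝ) / a ^ 4 * |t| ^ 3 * (a ^ 3 * u) = (s * |t| ^ 3) * (2 * u / a) := by
      field_simp
    rw [e]
    have h1 : 1 ≤ 2 * u / a := by rw [le_div_iff₀ ha0]; linarith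
    nlinarith
  have hApos' : 0 ≤ 15 * A * |t| ^ 3 := by positivity
  calc |phiNegLogDeriv u - A * exp (4 * t) + (A - (s : ℝ) / a) + A * (exp (4 * t) - 1 - 4 * t - 8 * t ^ 2) +
          (s : ℝ) * t ^ 3 / (a ^ 3 * u)|
      ≤ |phiNegLogDeriv u - A * exp (4 * t) + (A - (s : ℝ) / a)| + |A * (exp (4 * t) - 1 - 4 * t - 8 * t ^ 2)| +
          |(s : ℝ) * t ^ 3 / (a ^ 3 * u)| := by
        refine (abs_add_le _ _).trans ?_
        gcongr
        exact abs_add_le _ _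
    _ ≤ 1 / 200 + 15 * A * |t| ^ 3 + 2 * s / a ^ 4 * |t| ^ 3 := by linarith
    _ = 1 / 200 + (15 * A + 2 * s / a ^ 4) * |t| ^ 3 := by ring

/-- **Global form** (Markov inflation off the bulk): for every real `u`,
`|W_s′(u) − R(u−a) − c(u−a)²| ≤ 1/200 + C₃|u−a|³ + 10⁸(u−a)⁴(|W_s′(u)| + R|u−a| + c(u−a)²)`. -/
theorem global_bound (s : ℕ) (hs : 4 * 10 ^ 18 ≤ s) {A R c : ℝ} (hA : A = 4 * π * exp (4 * xiMode (s : ℝ)))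
    (hR : R = 4 * A + s / xiMode (s : ℝ) ^ 2) (hc : c = 8 * A - s / xiMode (s : ℝ) ^ 3) (u : ℝ) :
    |xiPotentialDeriv s u - R * (u - xiMode (s : ℝ)) - c * (u - xiMode (s : ℝ)) ^ 2| ≤
      1 / 200 + (15 * A + 2 * s / xiMode (s : ℝ) ^ 4) * |u - xiMode (s : ℝ)| ^ 3 +
        10 ^ 8 * (u - xiMode (s : ℝ)) ^ 4 *
          (|xiPotentialDeriv s u| + R * |u - xiMode (s : ℝ)| + c * (u - xiMode (s : ℝ)) ^ 2) := by
  obtain ⟨hApos, _, _, hR0, hc0, _⟩ := consts_facts s hs hA hR hc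
  have ha0 := (mode_facts s hs).1
  set a := xiMode (s : ℝ) with ha_def
  set t := u - a with ht
  have hC : 0 ≤ (15 * A + 2 * s / a ^ 4) * |t| ^ 3 := by positivity
  have hX : 0 ≤ |xiPotentialDeriv s u| + R * |t| + c * t ^ 2 := by positivity
  by_cases hb : |t| ≤ 1 / 100
  · have h := bulk_bound s hs hA hR hc hb
    have : 0 ≤ 10 ^ 8 * t ^ 4 * (|xiPotentialDeriv s u| + R * |t| + c * t ^ 2) := by positivity
    linarith
  · have hb : 1 / 100 < |t| := not_le.1 hb
    -- `10⁸ t⁴ ≥ 1`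
    have ht4 : 1 ≤ 10 ^ 8 * t ^ 4 := by
      have h1 : (1 / 100 : ℝ) ^ 4 ≤ |t| ^ 4 := pow_le_pow_left₀ (by norm_num) hb.le 4
      have e : |t| ^ 4 = t ^ 4 := by rw [← abs_pow, abs_of_nonneg (by positivity)]
      rw [e] at h1
      nlinarith
    have htri : |xiPotentialDeriv s u - R * t - c * t ^ 2| ≤ |xiPotentialDeriv s u| + R * |t| + c * t ^ 2 := by
      calc |xiPotentialDeriv s u - R * t - c * t ^ 2|
          ≤ |xiPotentialDeriv s u - R * t| + |c * t ^ 2| := abs_sub _ _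
        _ ≤ |xiPotentialDeriv s u| + |R * t| + |c * t ^ 2| := by gcongr; exact abs_sub _ _
        _ = |xiPotentialDeriv s u| + R * |t| + c * t ^ 2 := by
            rw [abs_mul, abs_of_pos hR0, abs_mul, abs_of_pos hc0, abs_of_nonneg (sq_nonneg t)]
    calc |xiPotentialDeriv s u - R * t - c * t ^ 2| ≤ 1 * (|xiPotentialDeriv s u| + R * |t| + c * t ^ 2) := by
          rw [one_mul]; exact htri
      _ ≤ 10 ^ 8 * t ^ 4 * (|xiPotentialDeriv s u| + R * |t| + c * t ^ 2) := mul_le_mul_of_nonneg_right ht4 hX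
      _ ≤ _ := by linarith

end Summit.RiemannHypothesis.RiemannHypothesis.Theorems.JensenPolynomials.SkewFar

end
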